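import Mathlib
import Literature.Probability.LatticeModels.SubcriticalFourier
import Literature.Probability.LatticeModels.DiscreteParseval
import Literature.Probability.LatticeModels.SharpnessProofs
import HarnessLib

/-!
# Stub `stub_spectralIsotropy` of line `diffusive-branch-is-nonsaturation` (crux
# `PrecisionLaplacian.DirectCorrelationStableTail`, stmt-CriticalPhenomena-4799): hyperoctahedral
# symmetry on the Fourier side

**Statement** (registered text, = `stub_spectralIsotropy` of the lead's skeleton).
(i) If `G : ℤ³ → ℝ` is invariant under coordinate permutations `x ↦ x ∘ σ` and sign flips
`x ↦ (x with x_j ↦ −x_j)`, then so is the approximate spectral density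
`g̃_L(k) = Σ_{z,z' ∈ Λ_L} G(z'−z) cos(k·(z'−z))` (`Λ_L = box 3 L = {−L,…,L}³`,
`k·z = phase 3 k z`) as a function of `k ∈ ℝ³`.
(ii) For a continuous `f : ℝ³ → ℝ` with both invariances and the symmetric cubical shell
`S = K_{ρ₂} ∖ K_{ρ₁}`, `K_ρ = [−ρ,ρ]³`:  `∫_S (k·y)² f(k) dk = (|y|₂²/3) ∫_S |k|₂² f(k) dk`.

**Proof.** (i) `phase 3 (k ∘ σ) w = phase 3 k (w ∘ σ⁻¹)` and
`phase 3 (k with k_j ↦ −k_j) w = phase 3 k (w with w_j ↦ −w_j)`; the maps `w ↦ w ∘ σ⁻¹` and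
`w ↦ (w with w_j ↦ −w_j)` are additive bijections of the cube `Λ_L`, so the double sum is
reindexed (`Finset.sum_nbij'`), and `G` is invariant.  (ii) Expand
`(k·y)² = Σ_{i,j} y_i y_j k_i k_j` and exchange the finite sum with the integral (the integrand is
continuous and `S` lies in the compact cube `K_{ρ₂}`).  The coordinate reflection
`k ↦ (k with k_i ↦ −k_i)` and the coordinate permutations are measure-preserving measurable
equivalences of `ℝ³` (`MeasureTheory.volume_preserving_pi`, `MeasureTheory.volume_preserving_arrowCongr'`)
leaving `S` and `f` invariant; the first turns `∫_S k_i k_j f` (`i ≠ j`) into its negative, so the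
cross terms vanish, and a transposition gives `∫_S k_i² f = ∫_S k_0² f`.  Hence both sides equal
`|y|₂² ∫_S k_0² f`.

Pure theorem file, no definitions, no `sorry`. [folklore]
-/

noncomputable section

namespace Summit.CriticalPhenomena.Ising3DConformalLimit.Cruxes.DirectCorrelationStableTail.DiffusiveBranchIsNonsaturation

open MeasureTheory Filter Topology
open scoped BigOperators
open Literature.Probability.LatticeModels

/-! ### Part (i): discrete hyperoctahedral symmetries of the box double sum -/

/-- Reindexing the double sum over `Λ_L × Λ_L` by an additive bijection `T` of the cube with
inverse `S`: `Σ_{z,z'} F(T(z'−z)) = Σ_{z,z'} F(z'−z)`. [folklore] -/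
theorem spectralIsotropy_sum_box_box_reindex (L : ℕ) (F : Site 3 → ℝ) (T S : Site 3 → Site 3)
    (hTS : ∀ z, T (S z) = z) (hST : ∀ z, S (T z) = z)
    (hT : ∀ z ∈ box 3 L, T z ∈ box 3 L) (hS : ∀ z ∈ box 3 L, S z ∈ box 3 L)
    (hsub : ∀ z z', T (z' - z) = T z' - T z) :
    ∑ z ∈ box 3 L, ∑ z' ∈ box 3 L, F (T (z' - z)) = ∑ z ∈ box 3 L, ∑ z' ∈ box 3 L, F (z' - z) := by
  refine Finset.sum_nbij' T S hT hS (fun z _ => hST z) (fun z _ => hTS z) (fun z _ => ?_)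
  refine Finset.sum_nbij' T S hT hS (fun z' _ => hST z') (fun z' _ => hTS z') (fun z' _ => ?_)
  rw [hsub]

/-- `phase 3 (k ∘ σ) w = phase 3 k (w ∘ σ⁻¹)`. [folklore] -/
theorem spectralIsotropy_phase_perm (σ : Equiv.Perm (Fin 3)) (k : Fin 3 → ℝ) (w : Site 3) :
    phase 3 (fun i => k (σ i)) w = phase 3 k (fun j => w (σ.symm j)) := by
  simp only [phase]
  rw [← Equiv.sum_comp σ (fun j => k j * ((w (σ.symm j) : ℤ) : ℝ))]
  simp

/-- `phase 3 (k with k_j ↦ −k_j) w = phase 3 k (w with w_j ↦ −w_j)`. [folklore] -/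
theorem spectralIsotropy_phase_flip (j : Fin 3) (k : Fin 3 → ℝ) (w : Site 3) :
    phase 3 (Function.update k j (-k j)) w = phase 3 k (Function.update w j (-w j)) := by
  simp only [phase]
  refine Finset.sum_congr rfl fun i _ => ?_
  rcases eq_or_ne i j with rfl | h
  · simp
  · simp [h]

/-- The cube `Λ_L` is invariant under coordinate permutations. [folklore] -/
theorem spectralIsotropy_perm_mem_box (L : ℕ) (σ : Equiv.Perm (Fin 3)) (z : Site 3)
    (hz : z ∈ box 3 L) : (fun j => z (σ j)) ∈ box 3 L := by
  rw [mem_box] at hz ⊢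
  exact fun i => hz (σ i)

/-- The cube `Λ_L` is invariant under the sign flip of one coordinate. [folklore] -/
theorem spectralIsotropy_flip_mem_box (L : ℕ) (j : Fin 3) (z : Site 3) (hz : z ∈ box 3 L) :
    Function.update z j (-z j) ∈ box 3 L := by
  rw [mem_box] at hz ⊢
  intro i
  rcases eq_or_ne i j with rfl | h
  · have := hz i
    simp only [Function.update_self]
    omega
  · simpa [h] using hz i

/-- **Part (i), permutations.**  `g̃_L(k ∘ σ) = g̃_L(k)` for a permutation-invariant `G`.
[folklore] -/
theorem spectralIsotropy_gtilde_perm (G : Site 3 → ℝ) (L : ℕ)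
    (hperm : ∀ (σ : Equiv.Perm (Fin 3)) (x : Site 3), G (fun i => x (σ i)) = G x)
    (σ : Equiv.Perm (Fin 3)) (k : Fin 3 → ℝ) :
    (∑ z ∈ box 3 L, ∑ z' ∈ box 3 L, G (z' - z) * Real.cos (phase 3 (fun i => k (σ i)) (z' - z))) =
      (∑ z ∈ box 3 L, ∑ z' ∈ box 3 L, G (z' - z) * Real.cos (phase 3 k (z' - z))) := by
  have key := spectralIsotropy_sum_box_box_reindex L (fun v => G v * Real.cos (phase 3 k v))
    (fun w j => w (σ.symm j)) (fun w j => w (σ j)) (fun z => by funext j; simp)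
    (fun z => by funext j; simp) (fun z hz => spectralIsotropy_perm_mem_box L σ.symm z hz)
    (fun z hz => spectralIsotropy_perm_mem_box L σ z hz) (fun z z' => by funext j; simp)
  rw [← key]
  refine Finset.sum_congr rfl fun z _ => Finset.sum_congr rfl fun z' _ => ?_
  rw [hperm σ.symm (z' - z), spectralIsotropy_phase_perm]

/-- **Part (i), sign flips.**  `g̃_L(k with k_j ↦ −k_j) = g̃_L(k)` for a flip-invariant `G`.
[folklore] -/
theorem spectralIsotropy_gtilde_flip (G : Site 3 → ℝ) (L : ℕ)
    (hflip : ∀ (j : Fin 3) (x : Site 3), G (Function.update x j (-x j)) = G x)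
    (j : Fin 3) (k : Fin 3 → ℝ) :
    (∑ z ∈ box 3 L, ∑ z' ∈ box 3 L,
        G (z' - z) * Real.cos (phase 3 (Function.update k j (-k j)) (z' - z))) =
      (∑ z ∈ box 3 L, ∑ z' ∈ box 3 L, G (z' - z) * Real.cos (phase 3 k (z' - z))) := by
  have hinv : ∀ z : Site 3,
      Function.update (Function.update z j (-z j)) j (-(Function.update z j (-z j)) j) = z := by
    intro z
    simp
  have key := spectralIsotropy_sum_box_box_reindex L (fun v => G v * Real.cos (phase 3 k v))
    (fun w => Function.update w j (-w j)) (fun w => Function.update w j (-w j)) hinv hinv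
    (fun z hz => spectralIsotropy_flip_mem_box L j z hz)
    (fun z hz => spectralIsotropy_flip_mem_box L j z hz)
    (fun z z' => by
      funext i
      rcases eq_or_ne i j with rfl | h
      · simp only [Pi.sub_apply, Function.update_self]
        ring
      · simp [h])
  rw [← key]
  refine Finset.sum_congr rfl fun z _ => Finset.sum_congr rfl fun z' _ => ?_
  rw [hflip j (z' - z), spectralIsotropy_phase_flip]

/-! ### Part (ii): isotropy of the second moment on a symmetric cubical shell -/

/-- Change of variables on an invariant set: if `e` is a measure-preserving measurable
equivalence of `ℝ³` with `e ⁻¹' S = S`, then `∫_S g ∘ e = ∫_S g`. [folklore] -/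
theorem spectralIsotropy_setIntegral_comp (e : (Fin 3 → ℝ) ≃ᵐ (Fin 3 → ℝ))
    (he : MeasurePreserving e volume volume) (S : Set (Fin 3 → ℝ)) (hS : e ⁻¹' S = S)
    (g : (Fin 3 → ℝ) → ℝ) : ∫ k in S, g (e k) = ∫ k in S, g k := by
  have := he.setIntegral_preimage_emb e.measurableEmbedding g S
  rwa [hS] at this

/-- The reflection `k ↦ (k with k_i ↦ −k_i)` is a measure-preserving measurable equivalence of
`ℝ³` (product of `±id` on the factors, `MeasureTheory.volume_preserving_pi`). [folklore] -/
theorem spectralIsotropy_exists_reflection (i : Fin 3) :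
    ∃ e : (Fin 3 → ℝ) ≃ᵐ (Fin 3 → ℝ), MeasurePreserving e volume volume ∧
      ∀ k, e k = Function.update k i (-k i) := by
  refine ⟨MeasurableEquiv.piCongrRight fun l =>
      if l = i then MeasurableEquiv.neg ℝ else MeasurableEquiv.refl ℝ, ?_, ?_⟩
  · exact volume_preserving_pi (α' := fun _ : Fin 3 => ℝ) (β' := fun _ : Fin 3 => ℝ)
      (f := fun l => ⇑(if l = i then MeasurableEquiv.neg ℝ else MeasurableEquiv.refl ℝ))
      (fun l => by
        split_ifs
        · exact Measure.measurePreserving_neg _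
        · exact MeasurePreserving.id _)
  · intro k
    funext l
    change (if l = i then MeasurableEquiv.neg ℝ else MeasurableEquiv.refl ℝ) (k l) = _
    rcases eq_or_ne l i with rfl | h
    · simp
    · simp [h]

/-- The coordinate permutation `k ↦ k ∘ σ⁻¹` is a measure-preserving measurable equivalence of
`ℝ³` (`MeasureTheory.volume_preserving_arrowCongr'`). [folklore] -/
theorem spectralIsotropy_exists_perm (σ : Equiv.Perm (Fin 3)) :
    ∃ e : (Fin 3 → ℝ) ≃ᵐ (Fin 3 → ℝ), MeasurePreserving e volume volume ∧
      ∀ k, e k = fun j => k (σ.symm j) :=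
  ⟨MeasurableEquiv.arrowCongr' σ (MeasurableEquiv.refl ℝ),
    volume_preserving_arrowCongr' σ _ (MeasurePreserving.id volume), fun _ => rfl⟩

/-- Membership in the cube `K_ρ = [−ρ,ρ]³`: all coordinates have absolute value `≤ ρ`.
[folklore] -/
theorem spectralIsotropy_mem_cube_iff (ρ : ℝ) (k : Fin 3 → ℝ) :
    k ∈ Set.pi Set.univ (fun _ : Fin 3 => Set.Icc (-ρ) ρ) ↔ ∀ l, |k l| ≤ ρ := by
  simp only [Set.mem_univ_pi, Set.mem_Icc, abs_le]

/-- The cube `K_ρ` is invariant under the reflection of one coordinate. [folklore] -/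
theorem spectralIsotropy_reflect_mem_cube_iff (i : Fin 3) (ρ : ℝ) (k : Fin 3 → ℝ) :
    Function.update k i (-k i) ∈ Set.pi Set.univ (fun _ : Fin 3 => Set.Icc (-ρ) ρ) ↔
      k ∈ Set.pi Set.univ (fun _ : Fin 3 => Set.Icc (-ρ) ρ) := by
  rw [spectralIsotropy_mem_cube_iff, spectralIsotropy_mem_cube_iff]
  constructor
  · intro h l
    rcases eq_or_ne l i with rfl | hl
    · simpa using h l
    · simpa [hl] using h l
  · intro h l
    rcases eq_or_ne l i with rfl | hl
    · simpa using h l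
    · simpa [hl] using h l

/-- The cube `K_ρ` is invariant under coordinate permutations. [folklore] -/
theorem spectralIsotropy_perm_mem_cube_iff (σ : Equiv.Perm (Fin 3)) (ρ : ℝ) (k : Fin 3 → ℝ) :
    (fun j => k (σ j)) ∈ Set.pi Set.univ (fun _ : Fin 3 => Set.Icc (-ρ) ρ) ↔
      k ∈ Set.pi Set.univ (fun _ : Fin 3 => Set.Icc (-ρ) ρ) := by
  rw [spectralIsotropy_mem_cube_iff, spectralIsotropy_mem_cube_iff]
  exact ⟨fun h l => by simpa using h (σ.symm l), fun h l => h (σ l)⟩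

/-- A map preserving membership in every cube `K_ρ` leaves each shell `K_{ρ₂} ∖ K_{ρ₁}`
invariant (as a preimage). [folklore] -/
theorem spectralIsotropy_preimage_shell (e : (Fin 3 → ℝ) → (Fin 3 → ℝ))
    (he : ∀ (ρ : ℝ) (k : Fin 3 → ℝ), e k ∈ Set.pi Set.univ (fun _ : Fin 3 => Set.Icc (-ρ) ρ) ↔
      k ∈ Set.pi Set.univ (fun _ : Fin 3 => Set.Icc (-ρ) ρ)) (ρ₁ ρ₂ : ℝ) :
    e ⁻¹' (Set.pi Set.univ (fun _ : Fin 3 => Set.Icc (-ρ₂) ρ₂) \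
        Set.pi Set.univ (fun _ : Fin 3 => Set.Icc (-ρ₁) ρ₁)) =
      Set.pi Set.univ (fun _ : Fin 3 => Set.Icc (-ρ₂) ρ₂) \
        Set.pi Set.univ (fun _ : Fin 3 => Set.Icc (-ρ₁) ρ₁) := by
  ext k
  simp only [Set.mem_preimage, Set.mem_sdiff, he]

/-- **Cross terms vanish.**  For `i ≠ j` and a flip-invariant `f`:
`∫_S k_i k_j f(k) dk = 0` on the shell `S = K_{ρ₂} ∖ K_{ρ₁}`. [folklore] -/
theorem spectralIsotropy_cross_eq_zero (f : (Fin 3 → ℝ) → ℝ) (ρ₁ ρ₂ : ℝ)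
    (hflip : ∀ (j : Fin 3) (k : Fin 3 → ℝ), f (Function.update k j (-k j)) = f k)
    {i j : Fin 3} (hij : i ≠ j) :
    ∫ k in Set.pi Set.univ (fun _ : Fin 3 => Set.Icc (-ρ₂) ρ₂) \
        Set.pi Set.univ (fun _ : Fin 3 => Set.Icc (-ρ₁) ρ₁), k i * k j * f k = 0 := by
  obtain ⟨e, he, hek⟩ := spectralIsotropy_exists_reflection i
  have hS := spectralIsotropy_preimage_shell e
    (fun ρ k => by rw [hek]; exact spectralIsotropy_reflect_mem_cube_iff i ρ k) ρ₁ ρ₂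
  have h := spectralIsotropy_setIntegral_comp e he _ hS (fun k => k i * k j * f k)
  simp only [hek, hflip, Function.update_self, Function.update_of_ne hij.symm] at h
  have : ∀ k : Fin 3 → ℝ, -k i * k j * f k = -(k i * k j * f k) := fun k => by ring
  simp_rw [this, integral_neg] at h
  linarith

/-- **Diagonal terms agree.**  For a permutation-invariant `f`:
`∫_S k_i² f(k) dk = ∫_S k_0² f(k) dk` on the shell `S = K_{ρ₂} ∖ K_{ρ₁}`. [folklore] -/
theorem spectralIsotropy_diag_eq (f : (Fin 3 → ℝ) → ℝ) (ρ₁ ρ₂ : ℝ)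
    (hperm : ∀ (σ : Equiv.Perm (Fin 3)) (k : Fin 3 → ℝ), f (fun i => k (σ i)) = f k)
    (i : Fin 3) :
    ∫ k in Set.pi Set.univ (fun _ : Fin 3 => Set.Icc (-ρ₂) ρ₂) \
        Set.pi Set.univ (fun _ : Fin 3 => Set.Icc (-ρ₁) ρ₁), k i * k i * f k =
      ∫ k in Set.pi Set.univ (fun _ : Fin 3 => Set.Icc (-ρ₂) ρ₂) \
        Set.pi Set.univ (fun _ : Fin 3 => Set.Icc (-ρ₁) ρ₁), k 0 * k 0 * f k := by
  obtain ⟨e, he, hek⟩ := spectralIsotropy_exists_perm (Equiv.swap 0 i)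
  have hS := spectralIsotropy_preimage_shell e
    (fun ρ k => by rw [hek]; exact spectralIsotropy_perm_mem_cube_iff _ ρ k) ρ₁ ρ₂
  have h := spectralIsotropy_setIntegral_comp e he _ hS (fun k => k 0 * k 0 * f k)
  simp only [hek, hperm, Equiv.symm_swap, Equiv.swap_apply_left] at h
  exact h

/-- Integrability of `k ↦ k_i k_j f(k)` on the shell (continuous integrand, bounded set).
[folklore] -/
theorem spectralIsotropy_integrableOn (f : (Fin 3 → ℝ) → ℝ) (hf : Continuous f) (ρ₁ ρ₂ : ℝ)
    (i j : Fin 3) :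
    IntegrableOn (fun k : Fin 3 → ℝ => k i * k j * f k)
      (Set.pi Set.univ (fun _ : Fin 3 => Set.Icc (-ρ₂) ρ₂) \
        Set.pi Set.univ (fun _ : Fin 3 => Set.Icc (-ρ₁) ρ₁)) volume := by
  have hc : Continuous fun k : Fin 3 → ℝ => k i * k j * f k := by fun_prop
  exact (hc.continuousOn.integrableOn_compact
    (isCompact_univ_pi fun _ => isCompact_Icc)).mono_set Set.sdiff_subset

/-- **Part (ii).**  Isotropy of the second moment on a symmetric cubical shell:
`∫_S (k·y)² f = (|y|₂²/3) ∫_S |k|₂² f`. [folklore] -/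
theorem spectralIsotropy_second_moment (f : (Fin 3 → ℝ) → ℝ) (ρ₁ ρ₂ : ℝ) (y : Fin 3 → ℝ)
    (hf : Continuous f)
    (hperm : ∀ (σ : Equiv.Perm (Fin 3)) (k : Fin 3 → ℝ), f (fun i => k (σ i)) = f k)
    (hflip : ∀ (j : Fin 3) (k : Fin 3 → ℝ), f (Function.update k j (-k j)) = f k) :
    ∫ k in Set.pi Set.univ (fun _ : Fin 3 => Set.Icc (-ρ₂) ρ₂) \
        Set.pi Set.univ (fun _ : Fin 3 => Set.Icc (-ρ₁) ρ₁), (∑ i, k i * y i) ^ 2 * f k =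
      ((∑ i, y i ^ 2) / 3) * ∫ k in Set.pi Set.univ (fun _ : Fin 3 => Set.Icc (-ρ₂) ρ₂) \
        Set.pi Set.univ (fun _ : Fin 3 => Set.Icc (-ρ₁) ρ₁), (∑ i, k i ^ 2) * f k := by
  set S : Set (Fin 3 → ℝ) := Set.pi Set.univ (fun _ : Fin 3 => Set.Icc (-ρ₂) ρ₂) \
    Set.pi Set.univ (fun _ : Fin 3 => Set.Icc (-ρ₁) ρ₁) with hSdef
  have hint : ∀ i j : Fin 3, Integrable (fun k : Fin 3 → ℝ => k i * k j * f k)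
      (volume.restrict S) := fun i j => spectralIsotropy_integrableOn f hf ρ₁ ρ₂ i j
  -- the matrix of second moments is a multiple of the identity
  have hI : ∀ i j : Fin 3, ∫ k in S, k i * k j * f k =
      if i = j then ∫ k in S, k 0 * k 0 * f k else 0 := by
    intro i j
    split_ifs with h
    · subst h
      exact spectralIsotropy_diag_eq f ρ₁ ρ₂ hperm i
    · exact spectralIsotropy_cross_eq_zero f ρ₁ ρ₂ hflip h
  -- expand the left-hand side
  have hL : ∫ k in S, (∑ i, k i * y i) ^ 2 * f k =
      ∑ i, ∑ j, y i * y j * ∫ k in S, k i * k j * f k := by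
    have hexp : ∀ k : Fin 3 → ℝ, (∑ i, k i * y i) ^ 2 * f k =
        ∑ i, ∑ j, y i * y j * (k i * k j * f k) := by
      intro k
      rw [sq, Finset.sum_mul_sum, Finset.sum_mul]
      refine Finset.sum_congr rfl fun i _ => ?_
      rw [Finset.sum_mul]
      refine Finset.sum_congr rfl fun j _ => ?_
      ring
    simp_rw [hexp]
    rw [integral_finsetSum _ (fun i _ => integrable_finsetSum _
      (fun j _ => (hint i j).const_mul _))]
    refine Finset.sum_congr rfl fun i _ => ?_
    rw [integral_finsetSum _ (fun j _ => (hint i j).const_mul _)]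
    refine Finset.sum_congr rfl fun j _ => ?_
    exact integral_const_mul _ _
  -- expand the right-hand side
  have hR : ∫ k in S, (∑ i, k i ^ 2) * f k = ∑ i, ∫ k in S, k i * k i * f k := by
    have hexp : ∀ k : Fin 3 → ℝ, (∑ i, k i ^ 2) * f k = ∑ i, k i * k i * f k := by
      intro k
      rw [Finset.sum_mul]
      refine Finset.sum_congr rfl fun i _ => ?_
      ring
    simp_rw [hexp]
    exact integral_finsetSum _ (fun i _ => hint i i)
  obtain ⟨c, hc⟩ : ∃ c : ℝ, ∫ k in S, k 0 * k 0 * f k = c := ⟨_, rfl⟩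
  have hd : ∀ i : Fin 3, ∫ k in S, k i * k i * f k = c := fun i => by rw [hI, if_pos rfl, hc]
  have ho : ∀ i j : Fin 3, i ≠ j → ∫ k in S, k i * k j * f k = 0 := fun i j h => by
    rw [hI, if_neg h]
  rw [hL, hR]
  simp only [Fin.sum_univ_three]
  rw [hd 0, hd 1, hd 2, ho 0 1 (by decide), ho 0 2 (by decide), ho 1 0 (by decide),
    ho 1 2 (by decide), ho 2 0 (by decide), ho 2 1 (by decide)]
  ring

/-! ### The registered stub -/

/-- **Stub F `stub_spectralIsotropy` (registered signature, verbatim; hyperoctahedral symmetry,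
Ising-free).**  (i) If `G` is invariant under coordinate permutations and sign flips, so is
`g̃_L(k) = Σ_{z,z'∈Λ_L} G(z'−z) cos(k·(z'−z))` as a function of `k`.  (ii) For a continuous
`f` on `ℝ³` with these invariances and a symmetric cubical shell `S = K_{ρ₂} ∖ K_{ρ₁}`:
`∫_S (k·y)² f = (|y|₂²/3) ∫_S |k|₂² f`. [folklore] -/
theorem stub_spectralIsotropy :
    (∀ (G : Site 3 → ℝ) (L : ℕ), (∀ (σ : Equiv.Perm (Fin 3)) (x : Site 3), G (fun i => x (σ i)) = G x) →
      (∀ (j : Fin 3) (x : Site 3), G (Function.update x j (-x j)) = G x) →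
      (∀ (σ : Equiv.Perm (Fin 3)) (k : Fin 3 → ℝ),
          (∑ z ∈ box 3 L, ∑ z' ∈ box 3 L, G (z' - z) * Real.cos (phase 3 (fun i => k (σ i)) (z' - z))) = (∑ z ∈ box 3 L, ∑ z' ∈ box 3 L, G (z' - z) * Real.cos (phase 3 k (z' - z)))) ∧
      (∀ (j : Fin 3) (k : Fin 3 → ℝ),
          (∑ z ∈ box 3 L, ∑ z' ∈ box 3 L, G (z' - z) * Real.cos (phase 3 (Function.update k j (-k j)) (z' - z)))
            = (∑ z ∈ box 3 L, ∑ z' ∈ box 3 L, G (z' - z) * Real.cos (phase 3 k (z' - z))))) ∧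
    (∀ (f : (Fin 3 → ℝ) → ℝ) (ρ₁ ρ₂ : ℝ) (y : Fin 3 → ℝ), Continuous f →
      (∀ (σ : Equiv.Perm (Fin 3)) (k : Fin 3 → ℝ), f (fun i => k (σ i)) = f k) →
      (∀ (j : Fin 3) (k : Fin 3 → ℝ), f (Function.update k j (-k j)) = f k) →
      ∫ k in Set.pi Set.univ (fun _ : Fin 3 => Set.Icc (-ρ₂) ρ₂) \ Set.pi Set.univ (fun _ : Fin 3 => Set.Icc (-ρ₁) ρ₁), (∑ i, k i * y i) ^ 2 * f k
        = ((∑ i, y i ^ 2) / 3) * ∫ k in Set.pi Set.univ (fun _ : Fin 3 => Set.Icc (-ρ₂) ρ₂) \ Set.pi Set.univ (fun _ : Fin 3 => Set.Icc (-ρ₁) ρ₁), (∑ i, k i ^ 2) * f k) :=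
  ⟨fun G L hperm hflip =>
    ⟨fun σ k => spectralIsotropy_gtilde_perm G L hperm σ k,
      fun j k => spectralIsotropy_gtilde_flip G L hflip j k⟩,
    fun f ρ₁ ρ₂ y hf hperm hflip => spectralIsotropy_second_moment f ρ₁ ρ₂ y hf hperm hflip⟩

end Summit.CriticalPhenomena.Ising3DConformalLimit.Cruxes.DirectCorrelationStableTail.DiffusiveBranchIsNonsaturation

end
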